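import Summits.BirchSwinnertonDyer.BirchSwinnertonDyer.Theorems.AlignedTransportAtTwoMainConjectureOfRankZeroBSDAtTwoHalfDescentLayerRing
import Summits.BirchSwinnertonDyer.Rank1Residual.X1.LambdaSqueezeAlgebra
import HarnessLib

/-!
# Route `AlignedTransportAtTwo`, crux C2 `MainConjectureOfRankZeroBSDAtTwo` (stmt-BirchSwinnertonDyer-22298):
# THE LAYER-GROWTH NUMBER IS AN INDEX, II — THE CYCLIC LAYER INDEX: for `F ∈ Λ ∖ {0}` with `λ(F) < φ(p^{n+1}) = pⁿ(p−1)`,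
# `#Λ/(F, Ψ_n) = p^{φ(p^{n+1})·μ(F) + λ(F)}`, `Ψ_n = Φ_{p^{n+1}}(1+T)` — Iwasawa's `e_{n+1} − e_n` for the cyclic module `Λ/(F)`, EXACT at every layer high for `λ(F)`

HONEST FRAMING (cell `bsd-f1-sign2`, WIDTH-5 attached prover seat `bsd-line-att-p5` gen 54 on line `birth` of the lead `bsd-line-att-p2`;
`--supports` stmt-BirchSwinnertonDyer-22298, closes nothing; BSD is NOT proved by any of this; the crux C2, its verdict «blocked-on
`Rank1Residual.GreenbergMuConjectureIrreducible`» and every registered stub (P / T / Kμ / LimDoor / MuIneqʳ / PFμ⁺) are untouched). THEOREMS ONLY —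
pure commutative algebra over `Λ = ℤ_p⟦T⟧`, any prime `p`; no `def`, no instance, no named fact, no `sorry`. Sequel of `…HalfDescentLayerRing` (this gen:
`𝒪 = Λ/(g)` is a DVR with residue field `𝔽_p` for an Eisenstein distinguished `g`, `#N = p^{length N}` over it). Lineage glue on g53's successor (1):
g53's `…HalfDescentHighGrowth.norm_tsum_pow_totient_eq` reads the LAYER-GROWTH NUMBER `φ·μ(F) + λ(F)` (`φ = φ(p^{n+1}) > λ(F)`) off ONE value `|F(ζ−1)|`;
THIS FILE reads it as the order of the cyclic layer quotient `Λ/(F, Ψ_n)`; the sequel `…HalfDescentLayerIndexModule` does `X/Ψ_n X` for `X` any finitely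
generated torsion `Λ`-module WITHOUT non-zero finite submodule, `char_Λ X = (F)`.

THE POINT (§1 for any Eisenstein distinguished `g` — monic, lower coefficients in `(p)`, `g(0) = p`, prime in `Λ` —, §2 for `g = Ψ_n`):
* ★ `span_coe_sup_span_coe_eq_of_natDegree_lt`: **`(f, g) = (f, p)`** for every distinguished `f` with `deg f < deg g` (`g − T^{deg g − deg f}·f = p·unit`);
  hence `#Λ/(f, g) = p^{deg f}` (`Λ/(f)` is `ℤ_p`-free of rank `deg f`) and `#Λ/(g, p^k) = p^{k·deg g}`;
* ★★ **`natCard_quotient_span_sup_span_coe_eq_pow`: `#Λ/(F, g) = p^{deg g·μ(F) + λ(F)}` for every `F ≠ 0` with `λ(F) < deg g`, NO hypothesis on `μ`**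
  (`p`-content `F = p^μ F₀`, Weierstrass `F₀ = P·U` with `deg P = λ(F)`, and multiplicativity of `#𝒪/(ab)` in the DOMAIN `𝒪 = Λ/(g)`); the same as
  `#𝒪/(F mod g)` and as a LENGTH: **`length_𝒪 𝒪/(F mod g) = deg g·μ(F) + λ(F)`** (`= v_π(F mod g)`; `p ∼ π^{deg g}`, `P ∼ π^{deg P}`);
* §2 `Ψ_n`: ★★ **`natCard_quotient_span_sup_span_cyclotomicLayer_eq_pow`: `#Λ/(F, Ψ_n) = p^{pⁿ(p−1)·μ(F) + λ(F)}` whenever `λ(F) < pⁿ(p−1)`**, plus the DVR /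
  residue-field / length packaging of the layer ring `𝒪_n = Λ/(Ψ_n)`. Reading: for the cyclic module `Λ/(F)` this is Iwasawa's `e_{n+1} − e_n = φ(p^{n+1})μ + λ`
  (Washington §13.3 — there for `n ≫ 0`, and for general modules up to the constant `ν`) — here EXACT, `ν`-free, from the FIRST layer that is high for `λ(F)`;
  with g53: `#Λ/(F, Ψ_n) = |F(ζ−1)|^{−φ(p^{n+1})}` for every `ζ` of order `p^{n+1}` — the growth number of `…HalfDescentHighGrowth` is an INDEX.
Memo `Cruxes/MainConjectureOfRankZeroBSDAtTwo/LAYER-INDEX-att-p5-g54.md`. BSD is not proved by any of this; nothing about any curve is asserted here.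

References: L. Washington, GTM 83, §7.1 (Prop. 7.2, Thm. 7.3), §13.2 (Lemma 13.7, Prop. 13.8), §13.3 (Lemmas 13.18–13.21, Thm. 13.13) [Washington1997];
B. Howard, Compositio 140 (2004), proof of Thm. 2.2.10 (the identity `(f, q_m) = (f, p)`) [Howard2004HeegnerKolyvagin]; J. Neukirch, A. Schmidt, K. Wingberg,
*Cohomology of Number Fields*, (5.3.17); J.-P. Serre, *Local Fields*, I §6 [SerreLocalFields1979].
-/

set_option linter.dupNamespace false
set_option autoImplicit false

noncomputable section

open scoped Classical Polynomial

namespace Summit.BirchSwinnertonDyer.BirchSwinnertonDyer.Theorems.AlignedTransportAtTwoHalfDescentLayerIndex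

open Literature.NumberTheory.EllipticCurves Literature.NumberTheory.EllipticCurves.IwasawaAlgebra
  Summit.BirchSwinnertonDyer.Rank1Residual.X1.MuLambda
  Summit.BirchSwinnertonDyer.Rank1Residual.X1.ParitySqueeze
  Summit.BirchSwinnertonDyer.Rank1Residual.Iwasawa
  Summit.BirchSwinnertonDyer.BirchSwinnertonDyer.Theorems.DefectPrime
  Summit.BirchSwinnertonDyer.BirchSwinnertonDyer.Theorems.AlignedTransportAtTwoCyclotomicLayerPrime
  Summit.BirchSwinnertonDyer.BirchSwinnertonDyer.Theorems.AlignedTransportAtTwoHalfDescentLayerRing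

universe v

variable {p : ℕ} [hp : Fact p.Prime]

section Eisenstein

variable {g : ℤ_[p][X]}

/-! ## §1 Indices in `Λ` modulo an Eisenstein distinguished `g`: `(f, g) = (f, p)` for `deg f < deg g`, and `#Λ/(F, g) = p^{deg g·μ(F) + λ(F)}` -/

/-- ★ **`(f, g) = (f, p)` in `Λ` for distinguished `f`, `g` with `deg f < deg g` and `g(0) = p`.** Write `f = T^e + p·h₀`, `g = T^d + p·h₁` (`h₁(0) = 1`);
then `g − T^{d−e}·f = p·(h₁ − T^{d−e}h₀)` with `h₁ − T^{d−e}h₀ ∈ Λˣ`. [cite: Washington1997, §7.1 (distinguished polynomials) and Prop. 7.2]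
[cite: Howard2004HeegnerKolyvagin, proof of Thm. 2.2.10 (the same identity for 𝔮 = T^m + p)] -/
theorem span_coe_sup_span_coe_eq_of_natDegree_lt {f : ℤ_[p][X]} (hf : f.IsDistinguishedAt (IsLocalRing.maximalIdeal ℤ_[p]))
    (hg : g.IsDistinguishedAt (IsLocalRing.maximalIdeal ℤ_[p])) (hg0 : PowerSeries.constantCoeff (g : IwasawaAlgebra p) = p)
    (hlt : f.natDegree < g.natDegree) :
    Ideal.span {(f : IwasawaAlgebra p)} ⊔ Ideal.span {(g : IwasawaAlgebra p)} =
      Ideal.span {(f : IwasawaAlgebra p)} ⊔ Ideal.span {PowerSeries.C (p : ℤ_[p])} := by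
  obtain ⟨h₀, hh₀⟩ := C_dvd_coe_sub_X_pow p hf
  obtain ⟨h₁, hh₁⟩ := C_dvd_coe_sub_X_pow p hg
  set e := f.natDegree with he
  set d := g.natDegree with hd
  have hp0 : (p : ℤ_[p]) ≠ 0 := Nat.cast_ne_zero.mpr hp.out.ne_zero
  have h10 : PowerSeries.constantCoeff h₁ = 1 := by
    have h := congrArg PowerSeries.constantCoeff hh₁
    rw [map_sub, map_pow, PowerSeries.constantCoeff_X, zero_pow (by omega), sub_zero, map_mul, PowerSeries.constantCoeff_C, hg0] at h
    exact mul_left_cancel₀ hp0 (by rw [← h, mul_one])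
  have hu : IsUnit (h₁ - PowerSeries.X ^ (d - e) * h₀) := by
    rw [PowerSeries.isUnit_iff_constantCoeff, map_sub, map_mul, map_pow, PowerSeries.constantCoeff_X, zero_pow (by omega), zero_mul,
      sub_zero, h10]
    exact isUnit_one
  have hXd : (PowerSeries.X : IwasawaAlgebra p) ^ d = PowerSeries.X ^ (d - e) * PowerSeries.X ^ e := by
    rw [← pow_add, Nat.sub_add_cancel hlt.le]
  have hkey : PowerSeries.C (p : ℤ_[p]) * (h₁ - PowerSeries.X ^ (d - e) * h₀) =
      (g : IwasawaAlgebra p) - PowerSeries.X ^ (d - e) * (f : IwasawaAlgebra p) := by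
    have ef : (f : IwasawaAlgebra p) = PowerSeries.X ^ e + PowerSeries.C (p : ℤ_[p]) * h₀ := by rw [← hh₀]; ring
    have eg : (g : IwasawaAlgebra p) = PowerSeries.X ^ d + PowerSeries.C (p : ℤ_[p]) * h₁ := by rw [← hh₁]; ring
    rw [ef, eg, hXd]
    ring
  apply le_antisymm
  · refine sup_le le_sup_left ((Ideal.span_singleton_le_iff_mem _).mpr ?_)
    have e1 : (g : IwasawaAlgebra p) = PowerSeries.X ^ (d - e) * (f : IwasawaAlgebra p) +
        PowerSeries.C (p : ℤ_[p]) * (h₁ - PowerSeries.X ^ (d - e) * h₀) := by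
      rw [hkey]; ring
    rw [e1]
    exact Submodule.add_mem _ (Ideal.mem_sup_left (Ideal.mul_mem_left _ _ (Ideal.mem_span_singleton_self _)))
      (Ideal.mem_sup_right (Ideal.mul_mem_right _ _ (Ideal.mem_span_singleton_self _)))
  · refine sup_le le_sup_left ((Ideal.span_singleton_le_iff_mem _).mpr ?_)
    obtain ⟨u, hu'⟩ := hu
    have hmem : PowerSeries.C (p : ℤ_[p]) * (h₁ - PowerSeries.X ^ (d - e) * h₀) ∈
        Ideal.span {(f : IwasawaAlgebra p)} ⊔ Ideal.span {(g : IwasawaAlgebra p)} := by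
      rw [hkey]
      exact Submodule.sub_mem _ (Ideal.mem_sup_right (Ideal.mem_span_singleton_self _))
        (Ideal.mem_sup_left (Ideal.mul_mem_left _ _ (Ideal.mem_span_singleton_self _)))
    have hfin := Ideal.mul_mem_right ((u⁻¹ : (IwasawaAlgebra p)ˣ) : IwasawaAlgebra p) _ hmem
    rwa [← hu', mul_assoc, Units.mul_inv, mul_one] at hfin

/-- **`#Λ/(f, g) = p^{deg f}`** for distinguished `f`, `g` with `deg f < deg g`, `g(0) = p` (`(f, g) = (f, p)` and `Λ/(f)` is `ℤ_p`-free of rank `deg f`).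
[cite: Washington1997, §13.2 (Lemma 13.7, Prop. 13.8)] -/
theorem natCard_quotient_span_coe_sup_span_coe {f : ℤ_[p][X]} (hf : f.IsDistinguishedAt (IsLocalRing.maximalIdeal ℤ_[p]))
    (hg : g.IsDistinguishedAt (IsLocalRing.maximalIdeal ℤ_[p])) (hg0 : PowerSeries.constantCoeff (g : IwasawaAlgebra p) = p)
    (hlt : f.natDegree < g.natDegree) :
    Nat.card (IwasawaAlgebra p ⧸ (Ideal.span {(f : IwasawaAlgebra p)} ⊔ Ideal.span {(g : IwasawaAlgebra p)})) = p ^ f.natDegree := by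
  haveI := free_quotient_pow p hf 1
  haveI := finite_quotient_pow p hf 1
  have h1 : Ideal.span {(f : IwasawaAlgebra p)} = Ideal.span {(f : IwasawaAlgebra p) ^ 1} := by rw [pow_one]
  rw [span_coe_sup_span_coe_eq_of_natDegree_lt hf hg hg0 hlt,
    show (PowerSeries.C (p : ℤ_[p]) : IwasawaAlgebra p) = PowerSeries.C ((p : ℤ_[p]) ^ 1) by rw [pow_one], h1,
    card_quotient_sup_span_C_pow, finrank_quotient_pow p hf 1, one_mul, one_mul]

/-- `#Λ/(g, p^k) = p^{k·deg g}` for distinguished `g` (`Λ/(g)` is `ℤ_p`-free of rank `deg g`). [cite: Washington1997, §13.2 (Lemma 13.7, Prop. 13.8)] -/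
theorem natCard_quotient_span_coe_sup_span_C_pow (hg : g.IsDistinguishedAt (IsLocalRing.maximalIdeal ℤ_[p])) (k : ℕ) :
    Nat.card (IwasawaAlgebra p ⧸ (Ideal.span {(g : IwasawaAlgebra p)} ⊔ Ideal.span {PowerSeries.C ((p : ℤ_[p]) ^ k)})) =
      p ^ (k * g.natDegree) := by
  haveI := free_quotient_pow p hg 1
  haveI := finite_quotient_pow p hg 1
  have h1 : Ideal.span {(g : IwasawaAlgebra p)} = Ideal.span {(g : IwasawaAlgebra p) ^ 1} := by rw [pow_one]
  rw [h1, card_quotient_sup_span_C_pow, finrank_quotient_pow p hg 1, one_mul]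

/-- `#(R/(ab)) = #(R/(a))·#(R/(b))` for `a ≠ 0` in a domain (`0 → R/(b) →(·a) R/(ab) → R/(a) → 0`). [folklore] -/
private theorem natCard_quotient_span_mul_of_ne_zero {R : Type*} [CommRing R] [IsDomain R] {a : R} (ha : a ≠ 0) (b : R) :
    Nat.card (R ⧸ Ideal.span {a * b}) = Nat.card (R ⧸ Ideal.span {a}) * Nat.card (R ⧸ Ideal.span {b}) := by
  have hle : Ideal.span {a * b} ≤ Ideal.span {a} := Ideal.span_singleton_le_span_singleton.mpr ⟨b, rfl⟩
  let f : R ⧸ Ideal.span {a * b} →+* R ⧸ Ideal.span {a} := Ideal.Quotient.factor hle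
  have hf : Function.Surjective f := Ideal.Quotient.factor_surjective hle
  let g : R →+ R ⧸ Ideal.span {a * b} := (Ideal.Quotient.mk (Ideal.span {a * b})).toAddMonoidHom.comp (AddMonoidHom.mulLeft a)
  have hgker : g.ker = (Ideal.span {b}).toAddSubgroup := by
    ext x
    simp only [g, AddMonoidHom.mem_ker, AddMonoidHom.coe_comp, Function.comp_apply, AddMonoidHom.coe_mulLeft,
      RingHom.toAddMonoidHom_eq_coe, AddMonoidHom.coe_coe, Ideal.Quotient.eq_zero_iff_mem, Ideal.mem_span_singleton,
      Submodule.mem_toAddSubgroup]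
    constructor
    · rintro ⟨c, hc⟩
      exact ⟨c, mul_left_cancel₀ ha (by rw [hc, mul_assoc])⟩
    · rintro ⟨c, rfl⟩
      exact ⟨c, by rw [mul_assoc]⟩
  have hgrange : g.range = f.toAddMonoidHom.ker := by
    ext y
    constructor
    · rintro ⟨x, rfl⟩
      simp only [g, f, RingHom.toAddMonoidHom_eq_coe, AddMonoidHom.mem_ker, AddMonoidHom.coe_comp, AddMonoidHom.coe_coe,
        Function.comp_apply, AddMonoidHom.coe_mulLeft, Ideal.Quotient.factor_mk, Ideal.Quotient.eq_zero_iff_mem]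
      exact Ideal.mem_span_singleton.mpr ⟨x, rfl⟩
    · intro hy
      obtain ⟨z, rfl⟩ := Ideal.Quotient.mk_surjective y
      simp only [f, RingHom.toAddMonoidHom_eq_coe, AddMonoidHom.mem_ker, AddMonoidHom.coe_coe, Ideal.Quotient.factor_mk,
        Ideal.Quotient.eq_zero_iff_mem, Ideal.mem_span_singleton] at hy
      obtain ⟨c, rfl⟩ := hy
      exact ⟨c, rfl⟩
  have h1 : Nat.card (R ⧸ Ideal.span {a * b}) =
      Nat.card ((R ⧸ Ideal.span {a * b}) ⧸ f.toAddMonoidHom.ker) * Nat.card f.toAddMonoidHom.ker :=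
    AddSubgroup.card_eq_card_quotient_mul_card_addSubgroup _
  have h2 : Nat.card ((R ⧸ Ideal.span {a * b}) ⧸ f.toAddMonoidHom.ker) = Nat.card (R ⧸ Ideal.span {a}) :=
    Nat.card_congr (QuotientAddGroup.quotientKerEquivOfSurjective f.toAddMonoidHom hf).toEquiv
  have h3 : Nat.card f.toAddMonoidHom.ker = Nat.card (R ⧸ Ideal.span {b}) := by
    rw [← hgrange]
    have e := QuotientAddGroup.quotientKerEquivRange g
    rw [← Nat.card_congr e.toEquiv, hgker]
    rfl
  rw [h1, h2, h3]

/-- `g ∤ p^k` in `Λ` for a distinguished `g` of positive degree (`λ(g) = deg g ≥ 1` but `λ(p^k) = 0`). [cite: Washington1997, §7.1] -/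
theorem not_coe_dvd_C_pow (hg : g.IsDistinguishedAt (IsLocalRing.maximalIdeal ℤ_[p])) (hd : 1 ≤ g.natDegree) (k : ℕ) :
    ¬ (g : IwasawaAlgebra p) ∣ PowerSeries.C ((p : ℤ_[p]) ^ k) := by
  rintro ⟨q, hq⟩
  have hC : (PowerSeries.C ((p : ℤ_[p]) ^ k) : IwasawaAlgebra p) ≠ 0 := C_pow_ne_zero k
  have hg' : (g : IwasawaAlgebra p) ≠ 0 := fun h ↦ hC (by rw [hq, h, zero_mul])
  have hq' : q ≠ 0 := fun h ↦ hC (by rw [hq, h, mul_zero])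
  have h := lam_C_pow (p := p) k
  rw [hq, lam_mul hg' hq', lam_coe_eq_natDegree hg] at h
  omega

/-- ★★ **THE LAYER INDEX OF A CYCLIC MODULE: `#Λ/(F, g) = p^{deg g·μ(F) + λ(F)}`** for an Eisenstein distinguished `g` (`g(0) = p`, prime in `Λ`) and
every `F ∈ Λ ∖ {0}` with `λ(F) < deg g` — NO hypothesis on `μ(F)`. Proof: `F = p^{μ}·P·U` (`p`-content, Weierstrass preparation, `deg P = λ(F)`); in the
domain `𝒪 = Λ/(g)` the count is multiplicative, `#𝒪/(p^μ) = p^{μ·deg g}` (`𝒪` is `ℤ_p`-free of rank `deg g`), `#𝒪/(P̄) = #Λ/(P, g) = #Λ/(P, p) = p^{deg P}`,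
and `Ū` is a unit. [cite: Washington1997, §13.3 (Lemmas 13.18–13.21, Thm. 13.13)] [cite: Washington1997, §7.1 (Thm. 7.3)] -/
theorem natCard_quotient_span_sup_span_coe_eq_pow (hg : g.IsDistinguishedAt (IsLocalRing.maximalIdeal ℤ_[p]))
    (hg0 : PowerSeries.constantCoeff (g : IwasawaAlgebra p) = p) (hgp : Prime (g : IwasawaAlgebra p)) {F : IwasawaAlgebra p} (hF : F ≠ 0)
    (hlam : lam F < g.natDegree) :
    Nat.card (IwasawaAlgebra p ⧸ (Ideal.span {F} ⊔ Ideal.span {(g : IwasawaAlgebra p)})) = p ^ (g.natDegree * mu F + lam F) := by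
  letI := isDomain_quotient hgp
  have hred := red_pfree_ne_zero hF
  set P : ℤ_[p][X] := (pfree F).weierstrassDistinguished hred with hP
  set U : IwasawaAlgebra p := (pfree F).weierstrassUnit hred with hU
  have hPU : pfree F = (P : IwasawaAlgebra p) * U := (pfree F).eq_weierstrassDistinguished_mul_weierstrassUnit hred
  have hPd : P.IsDistinguishedAt (IsLocalRing.maximalIdeal ℤ_[p]) := (pfree F).isDistinguishedAt_weierstrassDistinguished hred
  have hdeg : P.natDegree = lam F := (lam_eq_natDegree_weierstrassDistinguished (eq_C_pow_mu_mul_pfree F) hred).symm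
  have hUu : IsUnit U := (pfree F).isUnit_weierstrassUnit hred
  have hFfac : F = PowerSeries.C ((p : ℤ_[p]) ^ mu F) * ((P : IwasawaAlgebra p) * U) := by rw [← hPU]; exact eq_C_pow_mu_mul_pfree F
  -- pass to `𝒪 = Λ/(g)`
  have hC0 : Ideal.Quotient.mk (Ideal.span {(g : IwasawaAlgebra p)}) (PowerSeries.C ((p : ℤ_[p]) ^ mu F)) ≠ 0 := by
    rw [Ne, Ideal.Quotient.eq_zero_iff_mem, Ideal.mem_span_singleton]
    exact not_coe_dvd_C_pow hg (by omega) (mu F)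
  have hmkF : Ideal.Quotient.mk (Ideal.span {(g : IwasawaAlgebra p)}) F =
      Ideal.Quotient.mk (Ideal.span {(g : IwasawaAlgebra p)}) (PowerSeries.C ((p : ℤ_[p]) ^ mu F)) *
        (Ideal.Quotient.mk (Ideal.span {(g : IwasawaAlgebra p)}) (P : IwasawaAlgebra p) * Ideal.Quotient.mk (Ideal.span {(g : IwasawaAlgebra p)}) U) := by
    conv_lhs => rw [hFfac]
    rw [map_mul, map_mul]
  rw [← natCard_quotient_span_mk_eq_natCard_quotient_sup, hmkF, natCard_quotient_span_mul_of_ne_zero hC0,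
    Ideal.span_singleton_mul_right_unit (hUu.map _), natCard_quotient_span_mk_eq_natCard_quotient_sup,
    natCard_quotient_span_mk_eq_natCard_quotient_sup, sup_comm, natCard_quotient_span_coe_sup_span_C_pow hg,
    natCard_quotient_span_coe_sup_span_coe hPd hg hg0 (by rw [hdeg]; exact hlam), hdeg, ← pow_add]
  congr 1
  ring

/-- `Λ/(F, g)` is finite under the same hypotheses. [cite: Washington1997, §13.3 (Lemma 13.18)] -/
theorem finite_quotient_span_sup_span_coe (hg : g.IsDistinguishedAt (IsLocalRing.maximalIdeal ℤ_[p]))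
    (hg0 : PowerSeries.constantCoeff (g : IwasawaAlgebra p) = p) (hgp : Prime (g : IwasawaAlgebra p)) {F : IwasawaAlgebra p} (hF : F ≠ 0)
    (hlam : lam F < g.natDegree) :
    Finite (IwasawaAlgebra p ⧸ (Ideal.span {F} ⊔ Ideal.span {(g : IwasawaAlgebra p)})) := by
  apply Nat.finite_of_card_ne_zero
  rw [natCard_quotient_span_sup_span_coe_eq_pow hg hg0 hgp hF hlam]
  exact pow_ne_zero _ hp.out.ne_zero

/-- The same index in `𝒪 = Λ/(g)`: **`#𝒪/(F mod g) = p^{deg g·μ(F) + λ(F)}`**. [cite: Washington1997, §13.3 (Lemmas 13.18–13.21)] -/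
theorem natCard_quotient_span_mk_eq_pow (hg : g.IsDistinguishedAt (IsLocalRing.maximalIdeal ℤ_[p]))
    (hg0 : PowerSeries.constantCoeff (g : IwasawaAlgebra p) = p) (hgp : Prime (g : IwasawaAlgebra p)) {F : IwasawaAlgebra p} (hF : F ≠ 0)
    (hlam : lam F < g.natDegree) :
    Nat.card ((IwasawaAlgebra p ⧸ Ideal.span {(g : IwasawaAlgebra p)}) ⧸
      Ideal.span {Ideal.Quotient.mk (Ideal.span {(g : IwasawaAlgebra p)}) F}) = p ^ (g.natDegree * mu F + lam F) := by
  rw [natCard_quotient_span_mk_eq_natCard_quotient_sup, natCard_quotient_span_sup_span_coe_eq_pow hg hg0 hgp hF hlam]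

/-- Length form: **`length_𝒪 (𝒪/(F mod g)) = deg g·μ(F) + λ(F)`** (via `#N = p^{length N}` over the local ring `𝒪` with residue field `𝔽_p`).
[cite: Washington1997, §13.2–13.3] -/
theorem length_quotient_span_mk_eq (hg : g.IsDistinguishedAt (IsLocalRing.maximalIdeal ℤ_[p]))
    (hg0 : PowerSeries.constantCoeff (g : IwasawaAlgebra p) = p) (hgp : Prime (g : IwasawaAlgebra p)) {F : IwasawaAlgebra p} (hF : F ≠ 0)
    (hlam : lam F < g.natDegree) :
    Module.length (IwasawaAlgebra p ⧸ Ideal.span {(g : IwasawaAlgebra p)})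
        ((IwasawaAlgebra p ⧸ Ideal.span {(g : IwasawaAlgebra p)}) ⧸ Ideal.span {Ideal.Quotient.mk (Ideal.span {(g : IwasawaAlgebra p)}) F}) =
      (g.natDegree * mu F + lam F : ℕ) := by
  have hcard := natCard_quotient_span_mk_eq_pow hg hg0 hgp hF hlam
  haveI : Finite ((IwasawaAlgebra p ⧸ Ideal.span {(g : IwasawaAlgebra p)}) ⧸
      Ideal.span {Ideal.Quotient.mk (Ideal.span {(g : IwasawaAlgebra p)}) F}) := by
    apply Nat.finite_of_card_ne_zero
    rw [hcard]
    exact pow_ne_zero _ hp.out.ne_zero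
  have hlen := natCard_eq_pow_length_quotient_of_finite (p := p) hg0 hgp
    (N := (IwasawaAlgebra p ⧸ Ideal.span {(g : IwasawaAlgebra p)}) ⧸ Ideal.span {Ideal.Quotient.mk (Ideal.span {(g : IwasawaAlgebra p)}) F})
  rw [hcard] at hlen
  have hfin : Module.length (IwasawaAlgebra p ⧸ Ideal.span {(g : IwasawaAlgebra p)})
      ((IwasawaAlgebra p ⧸ Ideal.span {(g : IwasawaAlgebra p)}) ⧸ Ideal.span {Ideal.Quotient.mk (Ideal.span {(g : IwasawaAlgebra p)}) F}) ≠ ⊤ :=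
    Module.length_ne_top_iff.mpr Module.isFiniteLength_of_finite
  obtain ⟨ℓ, hℓ⟩ := ENat.ne_top_iff_exists.mp hfin
  rw [← hℓ, ENat.toNat_coe] at hlen
  rw [← hℓ, Nat.pow_right_injective hp.out.two_le hlen]

end Eisenstein

/-! ## §2 The layer ring `𝒪_n = Λ/(Ψ_n)`, `Ψ_n = Φ_{p^{n+1}}(1+T)`: a DVR with residue field `𝔽_p`, and `#Λ/(F, Ψ_n) = p^{pⁿ(p−1)·μ(F) + λ(F)}` -/

section Layer

variable (p)

/-- `Ψ_n(0) = p` (tree `DefectPrime.constantCoeff_coe_cyclotomic_comp`). [folklore] -/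
theorem constantCoeff_cyclotomicLayer (n : ℕ) :
    PowerSeries.constantCoeff ((((Polynomial.cyclotomic (p ^ (n + 1)) ℤ_[p]).comp (Polynomial.X + 1) : ℤ_[p][X]) : IwasawaAlgebra p)) = p :=
  constantCoeff_coe_cyclotomic_comp p n

/-- **The layer ring `𝒪_n = Λ/(Ψ_n) ≅ ℤ_p[ζ_{p^{n+1}}]` is a discrete valuation ring** with uniformiser `π = T mod Ψ_n` (`𝔪 = (π)`).
[cite: SerreLocalFields1979, I §6] [cite: Washington1997, §13.2] -/
theorem isDiscreteValuationRing_layerQuotient (n : ℕ) :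
    @IsDiscreteValuationRing (IwasawaAlgebra p ⧸
        Ideal.span {(((Polynomial.cyclotomic (p ^ (n + 1)) ℤ_[p]).comp (Polynomial.X + 1) : ℤ_[p][X]) : IwasawaAlgebra p)}) _
      (isDomain_quotient (prime_coe_cyclotomic_comp p n)) ∧
    @IsLocalRing.maximalIdeal _ _ (isLocalRing_quotient (prime_coe_cyclotomic_comp p n)) =
      Ideal.span {Ideal.Quotient.mk
        (Ideal.span {(((Polynomial.cyclotomic (p ^ (n + 1)) ℤ_[p]).comp (Polynomial.X + 1) : ℤ_[p][X]) : IwasawaAlgebra p)}) PowerSeries.X} :=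
  ⟨isDiscreteValuationRing_quotient (constantCoeff_cyclotomicLayer p n) (prime_coe_cyclotomic_comp p n),
    maximalIdeal_quotient_eq_span_mk_X (constantCoeff_cyclotomicLayer p n) (prime_coe_cyclotomic_comp p n)⟩

/-- **`#κ(𝒪_n) = p`** and **`#N = p^{length N}`** for every finite `𝒪_n`-module. [cite: SerreLocalFields1979, I §6] [cite: Washington1997, §13.2] -/
theorem natCard_eq_pow_length_layerQuotient (n : ℕ) {N : Type v} [AddCommGroup N]
    [Module (IwasawaAlgebra p ⧸
      Ideal.span {(((Polynomial.cyclotomic (p ^ (n + 1)) ℤ_[p]).comp (Polynomial.X + 1) : ℤ_[p][X]) : IwasawaAlgebra p)}) N] [Finite N] :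
    Nat.card (@IsLocalRing.ResidueField _ _ (isLocalRing_quotient (prime_coe_cyclotomic_comp p n))) = p ∧
    Nat.card N = p ^ (Module.length (IwasawaAlgebra p ⧸
      Ideal.span {(((Polynomial.cyclotomic (p ^ (n + 1)) ℤ_[p]).comp (Polynomial.X + 1) : ℤ_[p][X]) : IwasawaAlgebra p)}) N).toNat :=
  ⟨natCard_residueField_quotient (constantCoeff_cyclotomicLayer p n) (prime_coe_cyclotomic_comp p n),
    natCard_eq_pow_length_quotient_of_finite (constantCoeff_cyclotomicLayer p n) (prime_coe_cyclotomic_comp p n)⟩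

/-- `(P, Ψ_n) = (P, p)` and `#Λ/(P, Ψ_n) = p^{deg P}` for every distinguished `P` with `deg P < pⁿ(p−1)`. [cite: Washington1997, §13.2–13.3] -/
theorem natCard_quotient_span_coe_sup_span_cyclotomicLayer (n : ℕ) {P : ℤ_[p][X]} (hP : P.IsDistinguishedAt (IsLocalRing.maximalIdeal ℤ_[p]))
    (hlt : P.natDegree < p ^ n * (p - 1)) :
    Ideal.span {(P : IwasawaAlgebra p)} ⊔
        Ideal.span {(((Polynomial.cyclotomic (p ^ (n + 1)) ℤ_[p]).comp (Polynomial.X + 1) : ℤ_[p][X]) : IwasawaAlgebra p)} =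
      Ideal.span {(P : IwasawaAlgebra p)} ⊔ Ideal.span {PowerSeries.C (p : ℤ_[p])} ∧
    Nat.card (IwasawaAlgebra p ⧸ (Ideal.span {(P : IwasawaAlgebra p)} ⊔
        Ideal.span {(((Polynomial.cyclotomic (p ^ (n + 1)) ℤ_[p]).comp (Polynomial.X + 1) : ℤ_[p][X]) : IwasawaAlgebra p)})) = p ^ P.natDegree := by
  have hlt' : P.natDegree < ((Polynomial.cyclotomic (p ^ (n + 1)) ℤ_[p]).comp (Polynomial.X + 1)).natDegree := by
    rw [natDegree_cyclotomicLayer]; exact hlt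
  exact ⟨span_coe_sup_span_coe_eq_of_natDegree_lt hP (cyclotomic_comp_isDistinguishedAt_maximalIdeal p n) (constantCoeff_cyclotomicLayer p n) hlt',
    natCard_quotient_span_coe_sup_span_coe hP (cyclotomic_comp_isDistinguishedAt_maximalIdeal p n) (constantCoeff_cyclotomicLayer p n) hlt'⟩

/-- `(p^k) + (Ψ_n)` has index `p^{k·pⁿ(p−1)}`: in `𝒪_n`, `(p) = (π^{pⁿ(p−1)})` up to the count. [cite: Washington1997, §13.2 (Prop. 13.8)] -/
theorem natCard_quotient_span_cyclotomicLayer_sup_span_C_pow (n k : ℕ) :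
    Nat.card (IwasawaAlgebra p ⧸ (Ideal.span {(((Polynomial.cyclotomic (p ^ (n + 1)) ℤ_[p]).comp (Polynomial.X + 1) : ℤ_[p][X]) : IwasawaAlgebra p)} ⊔
      Ideal.span {PowerSeries.C ((p : ℤ_[p]) ^ k)})) = p ^ (k * (p ^ n * (p - 1))) := by
  rw [natCard_quotient_span_coe_sup_span_C_pow (cyclotomic_comp_isDistinguishedAt_maximalIdeal p n), natDegree_cyclotomicLayer]

variable {p}

/-- ★★ **THE LAYER INDEX OF A CYCLIC MODULE: `#Λ/(F, Ψ_n) = p^{pⁿ(p−1)·μ(F) + λ(F)}` for every `F ∈ Λ ∖ {0}` with `λ(F) < pⁿ(p−1) = φ(p^{n+1})`** —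
Iwasawa's `e_{n+1} − e_n = φ(p^{n+1})·μ + λ` for the cyclic module `Λ/(F)`, EXACT (no `ν`, no «`n ≫ 0`») from the first layer that is high for `λ(F)`;
with g53's `…HalfDescentHighGrowth.norm_tsum_pow_totient_eq` the right-hand side is `|F(ζ−1)|^{−φ(p^{n+1})}` for every `ζ` of order `p^{n+1}`.
[cite: Washington1997, §13.3 (Lemmas 13.18–13.21, Thm. 13.13)] [cite: Washington1997, §7.1 (Thm. 7.3)] -/
theorem natCard_quotient_span_sup_span_cyclotomicLayer_eq_pow {F : IwasawaAlgebra p} (hF : F ≠ 0) {n : ℕ} (hlam : lam F < p ^ n * (p - 1)) :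
    Nat.card (IwasawaAlgebra p ⧸ (Ideal.span {F} ⊔
      Ideal.span {(((Polynomial.cyclotomic (p ^ (n + 1)) ℤ_[p]).comp (Polynomial.X + 1) : ℤ_[p][X]) : IwasawaAlgebra p)})) =
        p ^ (p ^ n * (p - 1) * mu F + lam F) := by
  rw [← natDegree_cyclotomicLayer p n] at hlam ⊢
  exact natCard_quotient_span_sup_span_coe_eq_pow (cyclotomic_comp_isDistinguishedAt_maximalIdeal p n) (constantCoeff_cyclotomicLayer p n)
    (prime_coe_cyclotomic_comp p n) hF hlam

/-- The same in `𝒪_n`-currency, with the LENGTH: `#𝒪_n/(F mod Ψ_n) = p^{pⁿ(p−1)·μ(F) + λ(F)}` and `length_{𝒪_n} 𝒪_n/(F mod Ψ_n) = pⁿ(p−1)·μ(F) + λ(F)`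
(`= v_π(F mod Ψ_n)`: `F ≡ unit·π^{φμ+λ}`). [cite: Washington1997, §13.3 (Lemmas 13.18–13.21)] [cite: SerreLocalFields1979, I §6] -/
theorem natCard_and_length_layerQuotient_span_mk {F : IwasawaAlgebra p} (hF : F ≠ 0) {n : ℕ} (hlam : lam F < p ^ n * (p - 1)) :
    Nat.card ((IwasawaAlgebra p ⧸ Ideal.span {(((Polynomial.cyclotomic (p ^ (n + 1)) ℤ_[p]).comp (Polynomial.X + 1) : ℤ_[p][X]) : IwasawaAlgebra p)}) ⧸
        Ideal.span {Ideal.Quotient.mk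
          (Ideal.span {(((Polynomial.cyclotomic (p ^ (n + 1)) ℤ_[p]).comp (Polynomial.X + 1) : ℤ_[p][X]) : IwasawaAlgebra p)}) F}) =
      p ^ (p ^ n * (p - 1) * mu F + lam F) ∧
    Module.length (IwasawaAlgebra p ⧸ Ideal.span {(((Polynomial.cyclotomic (p ^ (n + 1)) ℤ_[p]).comp (Polynomial.X + 1) : ℤ_[p][X]) : IwasawaAlgebra p)})
        ((IwasawaAlgebra p ⧸ Ideal.span {(((Polynomial.cyclotomic (p ^ (n + 1)) ℤ_[p]).comp (Polynomial.X + 1) : ℤ_[p][X]) : IwasawaAlgebra p)}) ⧸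
          Ideal.span {Ideal.Quotient.mk
            (Ideal.span {(((Polynomial.cyclotomic (p ^ (n + 1)) ℤ_[p]).comp (Polynomial.X + 1) : ℤ_[p][X]) : IwasawaAlgebra p)}) F}) =
      (p ^ n * (p - 1) * mu F + lam F : ℕ) := by
  rw [← natDegree_cyclotomicLayer p n] at hlam ⊢
  exact ⟨natCard_quotient_span_mk_eq_pow (cyclotomic_comp_isDistinguishedAt_maximalIdeal p n) (constantCoeff_cyclotomicLayer p n)
      (prime_coe_cyclotomic_comp p n) hF hlam,
    length_quotient_span_mk_eq (cyclotomic_comp_isDistinguishedAt_maximalIdeal p n) (constantCoeff_cyclotomicLayer p n)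
      (prime_coe_cyclotomic_comp p n) hF hlam⟩

end Layer

end Summit.BirchSwinnertonDyer.BirchSwinnertonDyer.Theorems.AlignedTransportAtTwoHalfDescentLayerIndex

end
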